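import Summits.CriticalPhenomena.PercolationContinuityZ3.Theses.PercTorusSliceFilling
import Summits.CriticalPhenomena.PercolationContinuityZ3.Theorems.PercTorusSliceFillingSliceFillingUpperBoundLift

/-!
# `SliceFillingUpperBound` (route PercTorusSliceFilling, item stmt-CriticalPhenomena-5416)

For Bernoulli bond percolation with any edge density `p`, every `n ≥ 3` and every vertex `x` of
the discrete torus `T_n = (ℤ/nℤ)³` (`torusGraph 3 n`),

  `θ_{ℤ³}(p) ≤ P_{T_n,p}(C(x) is slice-filling)`,

where a torus cluster is SLICE-FILLING if in some direction `i` it meets every slice `{y_i = t}`.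
This is Lemma A (upper-bound direction) of the card
`Summits/CriticalPhenomena/PercolationContinuityZ3/Ideas/torus-slice-filling-identity-v2.md`; we
prove it for every dimension `d` (`theta_le_real_sliceFilling`) and specialise to `d = 3`
(`sliceFillingUpperBound_proof`).

## Proof (a static box-hull coupling; no inclusion–exclusion, no exploration)

Write `π z = x + (z mod n)` for the covering projection `ℤ^d → T_n` based at `x`, `E = E(ℤ^d)`.

1. `θ(p) = 1 - P_ℤ(|C(0)| < ∞)` (the percolation event is measurable) and
   `P_T(sf) ≥ 1 - P_T(not sf)`, so it suffices to show `P_T(not sf) ≤ P_ℤ(|C(0)| < ∞)`.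
2. COVER. If `C_T(x)` misses a slice in every direction, the cluster of the origin in the periodic
   lift `{e ∈ E | Sym2.map π e ∈ ω}` is confined to a slab of width `n` in every coordinate
   (`confined`), hence has a box-hull `b` in the finite family `boxes` of boxes through the origin
   with at most `n - 1` points per side (`exists_hull_of_confined`, `mem_boxes`); by LOCALITY
   (`determinedBy_of_subset_box`) the hull event `H_b = {s | hull of C_{s ∩ E}(0) is b}` then
   contains the LOCAL lift `{e ∈ W_b | Sym2.map π e ∈ ω}` (`W_b` = edge window of `b`). So
   `{not sf} ⊆ ⋃_b L_b⁻¹(H_b)`.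
3. TRANSFER. `Sym2.map π` is injective on `W_b` and maps it into `E(T_n)`
   (`injOn_map_proj_window`), so the local lift pushes `P_T` to `setBer(W_b, p)`
   (`setBernoulli_map_pullback`), exactly as the restriction `s ↦ s ∩ W_b` pushes `P_ℤ`; since
   `H_b` is determined by `W_b`, `P_T(L_b⁻¹ H_b) = P_ℤ(H_b)` (`real_preimage_localLift`).
4. The `H_b` are pairwise disjoint (`hull_unique`), measurable, and contained in
   `{|C(0)| < ∞} ∪ {s ⊄ E}` (a null set), so `∑_b P_ℤ(H_b) ≤ P_ℤ(|C(0)| < ∞)`.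

References: Benjamini–Schramm 1996 Thm 1 / Heydenreich–van der Hofstad 2017 Prop. 13.7 (torus and
`ℤ^d` clusters agree until wrapping; here in its static, finite-range form); Grimmett 1999 §1.3.
Tree API: `theta`, `percolatesAt`, `measurableSet_percolatesAt_holds`, `setBernoulli_ae_subset`,
`determinedBy_iff`, and the two helper files of this item.
-/

noncomputable section

namespace Summit.CriticalPhenomena.PercolationContinuityZ3.Theorems

namespace SliceFilling

open MeasureTheory ProbabilityTheory unitInterval
open Literature.Probability.Percolation Literature.Probability.LatticeModels

variable {d n : ℕ}

/-- **Transfer.** For a small box `b` and an event `A` determined by the edge window `W_b`, the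
probability that the local lift `{e ∈ W_b | Sym2.map π e ∈ ω}` of a torus configuration lies in
`A` equals the `ℤ^d`-probability of `A`. -/
theorem real_preimage_localLift (hn : 3 ≤ n) (x : TorusSite d n) (π : Site d → TorusSite d n)
    (hπ : ∀ z i, π z i = x i + ((z i : ℤ) : ZMod n)) (p : unitInterval) {b : Site d × Site d}
    (hb : ∀ i, b.2 i - b.1 i ≤ (n : ℤ) - 2) {A : Set (Set (Sym2 (Site d)))}
    (hA : DeterminedBy A {e ∈ (zdGraph d).edgeSet | ∃ z ∈ Set.Icc b.1 b.2, z ∈ e}) :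
    (bondPercolation (torusGraph d n) p).real
        ((fun t => {e | e ∈ {e ∈ (zdGraph d).edgeSet | ∃ z ∈ Set.Icc b.1 b.2, z ∈ e} ∧
          Sym2.map π e ∈ t}) ⁻¹' A) =
      (bondPercolation (zdGraph d) p).real A := by
  haveI : Fact (1 < n) := ⟨by omega⟩
  have hmeas : MeasurableSet A := measurableSet_of_determinedBy_window b hA
  have hT : (bondPercolation (torusGraph d n) p).map
      (fun t => {e | e ∈ {e ∈ (zdGraph d).edgeSet | ∃ z ∈ Set.Icc b.1 b.2, z ∈ e} ∧
        Sym2.map π e ∈ t}) =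
      setBer({e ∈ (zdGraph d).edgeSet | ∃ z ∈ Set.Icc b.1 b.2, z ∈ e}, p) :=
    setBernoulli_map_pullback (Sym2.map π) (injOn_map_proj_window hn x π hπ hb)
      (mapsTo_map_proj_window x π hπ b) p
  have hZ : (bondPercolation (zdGraph d) p).map
      (fun t => {e | e ∈ {e ∈ (zdGraph d).edgeSet | ∃ z ∈ Set.Icc b.1 b.2, z ∈ e} ∧ id e ∈ t}) =
      setBer({e ∈ (zdGraph d).edgeSet | ∃ z ∈ Set.Icc b.1 b.2, z ∈ e}, p) :=
    setBernoulli_map_pullback id (Set.injOn_id _) (fun e he => he.1) p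
  have hpre : (fun t => {e | e ∈ {e ∈ (zdGraph d).edgeSet | ∃ z ∈ Set.Icc b.1 b.2, z ∈ e} ∧
      id e ∈ t}) ⁻¹' A = A := by
    ext s
    refine (determinedBy_iff _ _).1 hA _ s ?_
    ext e
    simp only [id_eq, Set.mem_inter_iff, Set.mem_setOf_eq]
    tauto
  rw [← map_measureReal_apply (measurable_pullback _ _) hmeas, hT, ← hZ,
    map_measureReal_apply (measurable_pullback _ _) hmeas, hpre]

/-- **Main inequality**, for every dimension `d` and every `n ≥ 3`:
`θ_{ℤ^d}(p) ≤ P_{T_n,p}(∃ i, C(x) meets every slice {y_i = t})`. -/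
theorem theta_le_real_sliceFilling (hn : 3 ≤ n) (p : unitInterval) (x : TorusSite d n) :
    theta (zdGraph d) 0 p ≤ (bondPercolation (torusGraph d n) p).real
      {ω | ∃ i : Fin d, ∀ t : ZMod n, ∃ y ∈ openCluster ω x, y i = t} := by
  -- the projection based at `x`
  set π : Site d → TorusSite d n := fun z i => x i + ((z i : ℤ) : ZMod n) with hπdef
  have hπ : ∀ z i, π z i = x i + ((z i : ℤ) : ZMod n) := fun z i => rfl
  set μZ := bondPercolation (zdGraph d) p with hμZ
  set μT := bondPercolation (torusGraph d n) p with hμT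
  set SF : Set (BondConfig (TorusSite d n)) :=
    {ω | ∃ i : Fin d, ∀ t : ZMod n, ∃ y ∈ openCluster ω x, y i = t} with hSFdef
  -- the hull predicate, the hull events `{s | P b (C_{s ∩ E}(0))}`, the index set of boxes
  set P : Site d × Site d → Set (Site d) → Prop := fun b C =>
    C ⊆ Set.Icc b.1 b.2 ∧ ∀ i, (∃ z ∈ C, z i = b.1 i) ∧ ∃ z ∈ C, z i = b.2 i with hPdef
  have hPsub : ∀ b C, P b C → C ⊆ Set.Icc b.1 b.2 := fun b C h => h.1
  set boxes : Finset (Site d × Site d) :=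
    (Finset.Icc (fun _ : Fin d => 2 - (n : ℤ)) 0 ×ˢ
      Finset.Icc 0 (fun _ : Fin d => (n : ℤ) - 2)).filter
        (fun b => ∀ i, b.2 i - b.1 i ≤ (n : ℤ) - 2) with hboxes
  -- Step 1: complements
  have hperc : MeasurableSet (percolatesAt (0 : Site d) : Set (BondConfig (Site d))) :=
    measurableSet_percolatesAt_holds 0
  have hθ : theta (zdGraph d) 0 p = 1 - μZ.real (percolatesAt 0)ᶜ := by
    rw [theta, measureReal_compl hperc, probReal_univ]; ring
  have hSF : 1 - μT.real SFᶜ ≤ μT.real SF := by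
    have h := measureReal_union_le (μ := μT) SF SFᶜ
    rw [Set.union_compl_self, probReal_univ] at h
    linarith
  suffices key : μT.real SFᶜ ≤ μZ.real (percolatesAt 0)ᶜ by rw [hθ]; linarith
  -- Step 2: cover of `{not sf}` by the pulled-back hull events
  have hcover : SFᶜ ⊆ ⋃ b ∈ boxes,
      (fun t => {e | e ∈ {e ∈ (zdGraph d).edgeSet | ∃ z ∈ Set.Icc b.1 b.2, z ∈ e} ∧
        Sym2.map π e ∈ t}) ⁻¹' {s | P b (openCluster (s ∩ (zdGraph d).edgeSet) 0)} := by
    intro ω hω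
    have hω' : ∀ i : Fin d, ∃ t : ZMod n, ∀ y ∈ openCluster ω x, y i ≠ t := by
      intro i
      by_contra h
      push Not at h
      exact hω ⟨i, h⟩
    obtain ⟨r, hr, hconf⟩ := confined hn x π hπ ω hω'
    obtain ⟨b, hb1, hb2, hb3⟩ :=
      exists_hull_of_confined (n := n) (mem_openCluster_self _ _) hr hconf
    refine Set.mem_biUnion (mem_boxes hb1 hb2) ?_
    rw [Set.mem_preimage]
    have hlift : {e ∈ (zdGraph d).edgeSet | Sym2.map π e ∈ ω} ∈
        {s | P b (openCluster (s ∩ (zdGraph d).edgeSet) 0)} := by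
      rw [Set.mem_setOf_eq, Set.inter_eq_left.2 (Set.sep_subset _ _)]
      exact hb3
    refine ((determinedBy_iff _ _).1 (determinedBy_of_subset_box b (hPsub b)) _ _ ?_).1 hlift
    ext e
    simp only [Set.mem_inter_iff, Set.mem_setOf_eq]
    tauto
  -- Step 3/4: disjointness, measurability, null complement, containment
  have hdisj : Set.PairwiseDisjoint (↑boxes : Set (Site d × Site d))
      (fun b => {s : Set (Sym2 (Site d)) | P b (openCluster (s ∩ (zdGraph d).edgeSet) 0)}) := by
    intro b _ b' _ hbb'
    rw [Function.onFun, Set.disjoint_left]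
    intro s hs hs'
    exact hbb' (hull_unique hs hs')
  have hmeas : ∀ b ∈ boxes,
      MeasurableSet {s : Set (Sym2 (Site d)) | P b (openCluster (s ∩ (zdGraph d).edgeSet) 0)} :=
    fun b _ => measurableSet_of_determinedBy_window b (determinedBy_of_subset_box b (hPsub b))
  have hnull : μZ.real {s : BondConfig (Site d) | ¬ s ⊆ (zdGraph d).edgeSet} = 0 := by
    have h := setBernoulli_ae_subset (u := (zdGraph d).edgeSet) (p := p)
    rw [measureReal_eq_zero_iff]
    exact ae_iff.1 h
  have hsub :
      (⋃ b ∈ boxes, {s : Set (Sym2 (Site d)) | P b (openCluster (s ∩ (zdGraph d).edgeSet) 0)}) ⊆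
        (percolatesAt (0 : Site d))ᶜ ∪ {s | ¬ s ⊆ (zdGraph d).edgeSet} := by
    intro s hs
    rw [Set.mem_iUnion₂] at hs
    obtain ⟨b, -, hsb⟩ := hs
    by_cases hsE : s ⊆ (zdGraph d).edgeSet
    · left
      have hfin : (openCluster (s ∩ (zdGraph d).edgeSet) 0).Finite :=
        (Set.finite_Icc _ _).subset hsb.1
      rw [Set.inter_eq_left.2 hsE] at hfin
      exact fun hinf => hinf hfin
    · right; exact hsE
  calc μT.real SFᶜ
      ≤ μT.real (⋃ b ∈ boxes,
          (fun t => {e | e ∈ {e ∈ (zdGraph d).edgeSet | ∃ z ∈ Set.Icc b.1 b.2, z ∈ e} ∧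
            Sym2.map π e ∈ t}) ⁻¹' {s | P b (openCluster (s ∩ (zdGraph d).edgeSet) 0)}) :=
        measureReal_mono hcover (measure_ne_top _ _)
    _ ≤ ∑ b ∈ boxes, μT.real
          ((fun t => {e | e ∈ {e ∈ (zdGraph d).edgeSet | ∃ z ∈ Set.Icc b.1 b.2, z ∈ e} ∧
            Sym2.map π e ∈ t}) ⁻¹' {s | P b (openCluster (s ∩ (zdGraph d).edgeSet) 0)}) :=
        measureReal_biUnion_finset_le _ _
    _ = ∑ b ∈ boxes, μZ.real {s | P b (openCluster (s ∩ (zdGraph d).edgeSet) 0)} :=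
        Finset.sum_congr rfl fun b hb => real_preimage_localLift hn x π hπ p
          (Finset.mem_filter.1 hb).2 (determinedBy_of_subset_box b (hPsub b))
    _ = μZ.real (⋃ b ∈ boxes, {s | P b (openCluster (s ∩ (zdGraph d).edgeSet) 0)}) :=
        (measureReal_biUnion_finset hdisj hmeas).symm
    _ ≤ μZ.real ((percolatesAt (0 : Site d))ᶜ ∪ {s | ¬ s ⊆ (zdGraph d).edgeSet}) :=
        measureReal_mono hsub (measure_ne_top _ _)
    _ ≤ μZ.real (percolatesAt (0 : Site d))ᶜ + μZ.real {s | ¬ s ⊆ (zdGraph d).edgeSet} :=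
        measureReal_union_le _ _
    _ = μZ.real (percolatesAt (0 : Site d))ᶜ := by rw [hnull, add_zero]

end SliceFilling

open Summit.CriticalPhenomena.PercolationContinuityZ3.Theses.PercTorusSliceFilling in
/-- **`SliceFillingUpperBound`** (route PercTorusSliceFilling, Lemma A of the card, upper-bound
direction): for all `p`, all `n ≥ 3` and all `x ∈ T_n = (ℤ/nℤ)³`,
`θ_{ℤ³}(p) ≤ P_{T_n,p}(C(x) is slice-filling)`. -/
theorem sliceFillingUpperBound_proof : SliceFillingUpperBound := by
  intro p n hn x
  exact SliceFilling.theta_le_real_sliceFilling hn p x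

end Summit.CriticalPhenomena.PercolationContinuityZ3.Theorems
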